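import Summits.AtomisticToContinuum.HydrodynamicLimit.Theses.OneFlightGossipEngine
import Literature.MathematicalPhysics.KineticTheory.HardSphereEulerProofs
import Literature.Analysis.FluidPDE.HardSphereFlowJointMeasurable
import Literature.Analysis.FluidPDE.LocalForecastCorrector
import Summits.AtomisticToContinuum.HydrodynamicLimit.Theorems.OneFlightGossipEngineKineticCurrentsWindowLDUniformJensenTimeSum
import Summits.AtomisticToContinuum.HydrodynamicLimit.Theorems.OneFlightGossipEngineKineticCurrentsWindowLDUniformFibreExpMoment
import Summits.AtomisticToContinuum.HydrodynamicLimit.Theorems.OneFlightGossipEngineKineticCurrentsWindowLDUniformPathwiseWindow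
import Summits.AtomisticToContinuum.HydrodynamicLimit.Theorems.OneFlightGossipEngineKineticCurrentsWindowLDUniformWindowTransferOfRenyi
import Summits.AtomisticToContinuum.HydrodynamicLimit.Theorems.OneFlightGossipEngineKineticCurrentsWindowLDUniformAssembly
import Summits.AtomisticToContinuum.HydrodynamicLimit.Theorems.OneFlightGossipEngineKineticCurrentsWindowLDUniformClassTruncation

/-!
# Skeleton — crux `KineticCurrentsWindowLDUniform` (stmt-AtomisticToContinuum-14662),
# line `sigma-uniform-equilibrium-transfer`

Crux-plan skeleton for the idea card `Ideas/sigma-uniform-equilibrium-transfer.md` (ideator 1; triage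
r1-1: pass, r1-2: pass): **local Gibbs data are free at exponential scale, provided the equilibrium
input is LOCALLY UNIFORM in the reduced density (and in the frozen block data)**. The line is a
SPATIAL transfer: the crux for data `localGibbsLaw σ a u₀ θ₀` is reduced to the same window large
deviation bound at GLOBAL equilibrium (constant profiles, flow-invariant reference law, exact window
monotonicity) for the crux's class with coefficients FROZEN at a macroscopic point, with constants
uniform in the freezing point and locally uniform in the reduced density
(`stub_frozenEquilibriumCore`, the open core `C⁺`), plus two decay-free dynamical inputs under the
non-invariant local law — Rényi quasi-invariance over a kinetic window (`stub_windowRenyi`, the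
SHARED first lemma of cards 2/3/4, registered verbatim as in line `Sketch`) and local window
influence locality (`stub_localInfluence`, the local-Gibbs twin of AntiMazur's `InfluenceLocality`
stmt-13916 in the `Eventually`-in-`R` shape) — and two provable-grade statics-plus-bookkeeping
steps: the Rényi cost of freezing the profiles along a small displacement (`stub_staticFreezing`) and
the chessboard / corridor / dictionary transfer itself (`stub_chessboardTransfer`).

## Composition (`KineticCurrentsWindowLDUniform_of`, kernel-checked, no sorry outside the stubs)

The line docks onto the LANDED part of line `Sketch` (lead, cycle 1): for an admissible
`F = A(x):w⊗w + (b·w)G(x,|w|²)` the landed truncation `stub_classTruncation` (p91214) splits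
`F = F' + R` with `F'` BOUNDED in the radially weighted class and `|R| ≤ Y` with small static
exponential moments; the landed `stub_assembly` (p88778) + `stub_jensenTimeSum` (p86471) +
`stub_fibreExpMoment` (p86164) + `stub_pathwiseWindow` (p86158) + the window transfer (landed glue
`stub_windowTransfer_of_renyi` p89950 applied to `stub_windowRenyi`) reduce the crux to the
bounded-class local-Gibbs statement `S6` (= `Sketch.stub_boundedClassWindowLD`, registered). THIS
line supplies `S6` by the spatial transfer:

    S6  ⇐  stub_chessboardTransfer stub_staticFreezing stub_localInfluence
             stub_frozenEquilibriumCore (window transfer)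

so that `KineticCurrentsWindowLDUniform_of = Sketch-assembly ∘ (S1 S2 S3 S4, S5 ← stub_windowRenyi,
S6 ← this line)`. Boundedness of `F'` is what makes the transfer cheap: the localisation error is
`≤ 2B·#bad` (influence locality in bad-COUNT currency suffices — triage r1-2 sharpening (2) is
discharged by the truncation instead of a kinetic-energy split), coefficient freezing costs
`ω_V(L) + 2B·1_{|v|>V}` per particle, block margins cost `B·o(N_b)` deterministically.

Proof plan inside `stub_chessboardTransfer` (for the lead; three natural children, ≤ 3 as D-0019 wants):
(T-a) under `λ_loc` (continuous profiles): split `X = Σ_{c ∈ (ℤ/3)³} X^{(c)}` by the colour of the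
block (side `L = 1/(3m)`, `m = m(N) → ∞`, `w_N ≪ Rℓ_N ≪ L ≪ 1`) containing the INITIAL position,
Hölder over the 27 colours (`β ↦ 27β`, once), freeze the coefficients of `F'` at block centres
(Jensen in time S1 + window transfer S5 + fibre moments S2: `o(N)`), localise `Y_i ↦ Ŷ_i` by the
range-`Rℓ_N` cluster forecast `localClusterState` (error `≤ 2B·#bad`, `stub_localInfluence` with
`K = pt`); (T-b) change the measure to the colour-`c` frozen law `λ_frz,c` (profiles composed with
the map `π_c` = "centre of the `3L`-cube centred at the nearest colour-`c` block", displacement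
`≤ 3√3 L/2`; `stub_staticFreezing` + Hölder `β ↦ qβ`), pass to the grand-canonical hard-core law
(ensemble equivalence at LD scale, packing `≤ η₀`: Ruelle1969 Ch. 3–4) and FACTORISE over the
same-colour regions `b⁺ = b + B(Rℓ_N)` by the spatial Markov property given the corridor
configuration (corridor width `≥ 2L − 2Rℓ_N`); occupation large deviations of the blocks are a
product of one-block bounds; (T-c) per block: annulus comparison with the equilibrium law of the
block torus `T_b ⊃ b⁺` (partition-function ratio `e^{O(N_b Rℓ_N/L)} = e^{o(N_b)}`, triage r1-1
sharpening), forecast = true `T_b`-dynamics up to `2B·#bad(T_b)` (`stub_localInfluence` with the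
compact family `K = 𝕋³ × [σ₁,σ₂]` of CONSTANT profiles `(1, u₀(x_b), θ₀(x_b))`), margin particles
`B·o(N_b)`, rescale `T_b` to the unit torus (`N'' + 1 ≍ N L³`, `σ'' = σ((N''+1)/(N+1))^{1/3}/L''
∈ [σ₁, σ₂]`, `τ'' = τσ''/σ`, velocities and hence `θ₀(x_b)`, `u₀(x_b)` unchanged) and apply
`stub_frozenEquilibriumCore` at the frozen point `x₀ = x_b` — its `(x₀, σ)`-uniform `N₀` and its
eventually-in-`τ` window are exactly what blocks of different activity `a(x_b)` need
(`σ''³ ≍ σ³ a(x_b)/∫a ∈ [σ³ a_min/∫a, η₀]`; `η₀ := min(σ₀³/2, 1/8)`).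

## Disproof.lean (cycle 1) honoured
§1 `not_kineticCurrentsWindowLDUniformAllN` (`∃ N₀` load-bearing; free gas false): collisions enter
ONLY through `stub_frozenEquilibriumCore`, which keeps `∃ N₀` and a density floor `σ₁ > 0` (blocks
have `N'' ≍ N^{1/2} → ∞` particles); every other stub is true for the free gas. §3
`not_kineticCurrentsWindowLDUniformAllBeta` / `tilt_window_lower_bound` (`β₀` static, uniform in
`τ`): `β₀` is fixed BEFORE `τ` everywhere; the transfer multiplies `β` only by the fixed exponents
`27` (colours), `q` (freezing Hölder), `2` (localisation Hölder), `2` (truncation Hölder of the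
`Sketch` assembly), never by a `τ`-dependent factor; `stub_frozenEquilibriumCore` chooses `β₀` after
the growth constant `C` and the profile ranges only. §4 `not_kineticCurrentsWindowLDUniformWithoutOrthMom`
(`⊥ v_j` load-bearing): all three orthogonality clauses travel VERBATIM into
`stub_frozenEquilibriumCore` (same `F`, same `u₀, θ₀` fields, frozen point). §2
`kcw_orth_energy_redundant`: `⊥ ‖v‖²` is kept (not redundant in the radially weighted class of S6).
No `Negative/` lemma has landed for this crux (2026-08-16); `ledger negatives` (15): none is a
window-LD / transfer / influence statement.
-/

noncomputable section

open MeasureTheory Set Filter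
open scoped ENNReal Topology Classical

namespace Summit.AtomisticToContinuum.HydrodynamicLimit.Cruxes.KineticCurrentsWindowLDUniform.SigmaUniformEquilibriumTransfer

open Literature.Analysis.FluidPDE (HardSphereFlow Config localMaxwellian canonicalDensity liouville
  localClusterState)
open Literature.MathematicalPhysics.KineticTheory (T3 V3 hsDiameter localGibbsLaw localGibbsMeasure
  localGibbsProfile)
open Summit.AtomisticToContinuum.HydrodynamicLimit.Theses.OneFlightGossipEngine
  (KineticCurrentsWindowLDUniform)

/-! ## Stubs (signatures fully expanded over tree vocabulary; the registry matches `--supports`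
proofs by name + signature text) -/

/-- **Stub 1 — RÉNYI QUASI-INVARIANCE OF THE LOCAL GIBBS LAW OVER A KINETIC WINDOW** (the card's
first lemma `WindowQuasiInvariance`, in the one-sided order-`p` form shared with line `Sketch`
(`stub_windowRenyi`, same name and signature: ONE proof serves both lines; triage r1-1/r1-2: "file
QI ≡ WQI once"). For continuous positive profiles and `σ ≤ 1/2` there is `p > 1` (any
`p < θ_max/(θ_max − θ_min)` is the exact static integrability window, triage r1-1) such that for
every window parameter `τ`, every `δ > 0`, every flow family and all large `N`, uniformly in
`r ∈ [0, τ(N+1)^{-1/3}]`: `∫ (ψ∘Φ_{-r})^p ψ^{1-p} dL ≤ e^{pδ(N+1)}` (`ψ` the canonical local Gibbs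
density, `L` Liouville). Free gas: dominated convergence (TRUE); isothermal profiles: conservation
laws (landed as `stub_windowTransfer_isothermal`, p89694); general profiles: "no LD-cheap energy /
momentum courier across `∇θ₀, ∇u₀` within a kinetic window" — research-level, decay-free (size L).
Leans on: `canonicalDensity`, `liouville`, `HardSphereFlow.measurePreserving`. -/
theorem stub_windowRenyi :
    ∀ (a θ₀ : T3 → ℝ) (u₀ : T3 → V3), Continuous a → Continuous θ₀ → Continuous u₀ →
    (∀ x, 0 < a x) → (∀ x, 0 < θ₀ x) → ∀ σ : ℝ, 0 < σ → σ ≤ 1 / 2 →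
    ∃ p : ℝ, 1 < p ∧ ∀ τ : ℝ, 0 < τ → ∀ δ : ℝ, 0 < δ →
    ∀ Φ : (N : ℕ) →
      HardSphereFlow (Literature.Analysis.FluidPDE.Torus.geometry (Fin 3)) (hsDiameter σ N) (N + 1),
    ∃ N₀ : ℕ, ∀ N : ℕ, N₀ ≤ N → ∀ r ∈ Set.Icc (0 : ℝ) (τ * ((N : ℝ) + 1) ^ (-(1 / 3 : ℝ))),
      ∫⁻ z, ENNReal.ofReal (canonicalDensity (Literature.Analysis.FluidPDE.Torus.geometry (Fin 3))
            (hsDiameter σ N) (N + 1) (localGibbsProfile a u₀ θ₀) ((Φ N).flow (-r) z)) ^ p *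
          ENNReal.ofReal (canonicalDensity (Literature.Analysis.FluidPDE.Torus.geometry (Fin 3))
            (hsDiameter σ N) (N + 1) (localGibbsProfile a u₀ θ₀) z) ^ (1 - p)
        ∂(liouville (Literature.Analysis.FluidPDE.Torus.geometry (Fin 3)) (N + 1) (hsDiameter σ N)) ≤
      ENNReal.ofReal (Real.exp (p * (δ * ((N : ℝ) + 1)))) := by
  sorry

/-- **Stub 2 — STATIC FREEZING (Rényi cost of freezing the profiles along a small displacement).**
For continuous positive profiles, `σ ≤ 1/2`, an order `p > 1` and `δ > 0` there is `ρ₀ > 0` such that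
for EVERY measurable self-map `π` of `𝕋³` moving points by at most `ρ₀` (in the transfer: `π_c x` =
centre of the `3L`-cube about the colour-`c` block nearest to `x`, `L → 0`) and every `N`, the Rényi
divergence of order `p` of the local Gibbs law from the law with FROZEN profiles
`(a∘π, u₀∘π, θ₀∘π)` is at most `δ(N+1)`: `∫ ψ^p ψ_π^{1-p} dL ≤ e^{pδ(N+1)}`. No dynamics: the
log-ratio is `log(Z_π/Z) + Σ_i [log a(x_i) − log a(πx_i) + quadratic in v_i with coefficients
O(ω(ρ₀))]`, `ω` the joint modulus of continuity of `(log a, u₀, 1/θ₀)` on the compact torus, so the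
fibrewise Gaussian MGF gives `≤ c(p)·ω(ρ₀)` nats per particle and the partition-function ratio the
same (size M; provable now over `lintegral_localGibbsMeasure` / `velMeasure` as in the landed
`stub_fibreExpMoment`). Uniform in `N`, `σ` and the flow (the hard-core indicator cancels). -/
theorem stub_staticFreezing :
    ∀ (a θ₀ : T3 → ℝ) (u₀ : T3 → V3), Continuous a → Continuous θ₀ → Continuous u₀ →
    (∀ x, 0 < a x) → (∀ x, 0 < θ₀ x) → ∀ σ : ℝ, 0 < σ → σ ≤ 1 / 2 →
    ∀ p : ℝ, 1 < p → ∀ δ : ℝ, 0 < δ → ∃ ρ₀ : ℝ, 0 < ρ₀ ∧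
    ∀ π : T3 → T3, Measurable π → (∀ x, dist (π x) x ≤ ρ₀) → ∀ N : ℕ,
      ∫⁻ z, ENNReal.ofReal (canonicalDensity (Literature.Analysis.FluidPDE.Torus.geometry (Fin 3))
            (hsDiameter σ N) (N + 1) (localGibbsProfile a u₀ θ₀) z) ^ p *
          ENNReal.ofReal (canonicalDensity (Literature.Analysis.FluidPDE.Torus.geometry (Fin 3))
            (hsDiameter σ N) (N + 1) (localGibbsProfile (a ∘ π) (u₀ ∘ π) (θ₀ ∘ π)) z) ^ (1 - p)
        ∂(liouville (Literature.Analysis.FluidPDE.Torus.geometry (Fin 3)) (N + 1) (hsDiameter σ N)) ≤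
      ENNReal.ofReal (Real.exp (p * (δ * ((N : ℝ) + 1)))) := by
  sorry

/-- **Stub 3 — LOCAL WINDOW INFLUENCE LOCALITY, `Eventually` in the range, uniformly over compact
families of data** (the card's `LocalWindowInfluenceLocality`; local-Gibbs twin of the typed crux
`AntiMazurCoboundaries.InfluenceLocality`, stmt-13916, whose standing disprover recommends exactly the
`∃ R₀ ∀ R ≥ R₀` shape used here — badness is not monotone in `R`, `Cruxes/InfluenceLocality/Disproof.lean`
§D/item 5). Particle `i` is BAD if at some `t ∈ [0, T ℓ_N]`, `ℓ_N = (N+1)^{-1/3}`, its true state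
differs from its range-`Rℓ_N` cluster forecast `localClusterState Ψ (Rℓ_N) t z i` (only the
particles initially within `Rℓ_N` evolved, by their isolated dynamics `Ψ`). For every compact family
`k ↦ (a_k, θ₀,k, u₀,k, s_k)` of continuous positive profiles and reduced densities `s_k ≤ 1/2`
(jointly continuous in `(k, x)`), every horizon `T`, rate `lam` and `δ > 0`:
`∃ R₀ ∀ R ≥ R₀ ∃ N₀ ∀ k ∀ N ≥ N₀ ∀ Φ Ψ : ∫ exp(lam·#bad) dλ_k^N ≤ e^{δ(N+1)}`. Used twice by the
transfer: `K = pt` (the given local Gibbs data) and `K = 𝕋³ × [σ₁, σ₂]` with CONSTANT profiles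
`(1, u₀(x₀), θ₀(x₀))` (the rescaled block tori; `R'' = R·σ''/σ` varies with the block, whence
`Eventually`). Content (13916 disprover, item 4): an `N`-uniform exponential-moment bound at FIXED
density on long time-ordered chains of scheduled pair collisions (relay rows force
`R₀ ≳ (σ + v̄T)·exp(lam/2)`); in print only Boltzmann–Grad / short times (Alexander1975, GST2013 Ch. 5,
BGSSAnnals2023). Decay-free but research-level (size L). Compact-family uniformity: every such proof
uses only bounds and moduli of continuity of the data. -/
theorem stub_localInfluence :
    ∀ (K : Type) [TopologicalSpace K] [CompactSpace K]
      (a θ₀ : K → T3 → ℝ) (u₀ : K → T3 → V3) (s : K → ℝ),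
      Continuous (Function.uncurry a) → Continuous (Function.uncurry θ₀) →
      Continuous (Function.uncurry u₀) → Continuous s →
      (∀ k x, 0 < a k x) → (∀ k x, 0 < θ₀ k x) → (∀ k, 0 < s k) → (∀ k, s k ≤ 1 / 2) →
    ∀ (T lam δ : ℝ), 0 < T → 0 < lam → 0 < δ → ∃ R₀ : ℝ, 0 < R₀ ∧ ∀ R : ℝ, R₀ ≤ R →
    ∃ N₀ : ℕ, ∀ k : K, ∀ N : ℕ, N₀ ≤ N →
    ∀ (Φ : HardSphereFlow (Literature.Analysis.FluidPDE.Torus.geometry (Fin 3)) (hsDiameter (s k) N) (N + 1))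
      (Ψ : (n : ℕ) →
        HardSphereFlow (Literature.Analysis.FluidPDE.Torus.geometry (Fin 3)) (hsDiameter (s k) N) n),
      ∫⁻ z, ENNReal.ofReal (Real.exp (lam *
          ((Finset.univ.filter fun i : Fin (N + 1) =>
              ∃ t ∈ Set.Icc (0 : ℝ) (T * ((N : ℝ) + 1) ^ (-(1 / 3 : ℝ))),
                (Φ.flow t z) i ≠
                  localClusterState Ψ (R * ((N : ℝ) + 1) ^ (-(1 / 3 : ℝ))) t z i).card : ℝ)))
        ∂(localGibbsLaw (s k) (a k) (u₀ k) (θ₀ k) N Φ) ≤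
      ENNReal.ofReal (Real.exp (δ * ((N : ℝ) + 1))) := by
  sorry

/-- **Stub 4 — THE OPEN CORE `C⁺`: EQUILIBRIUM WINDOW LD FOR THE BOUNDED (RADIALLY WEIGHTED)
CLASS WITH COEFFICIENTS FROZEN AT A MACROSCOPIC POINT, UNIFORM IN THE FREEZING POINT, LOCALLY
UNIFORM IN THE REDUCED DENSITY, EVENTUALLY IN THE WINDOW.** There is a universal `σ₀ > 0` such that
for continuous `θ₀ > 0`, `u₀` on `𝕋³`, a density range `0 < σ₁ ≤ σ₂ < σ₀` and a growth constant `C`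
there is `β₀ > 0` (depending on these only — Disproof §3) such that for every BOUNDED
`F = H(x,|w|²)A(x):(w⊗w) + (b(x)·w)G(x,|w|²)`, `w = v − u₀(x)`, continuous, `|F| ≤ C(1+|v|²)`,
`⊥ 1, v_j, |v|²` under `M_{1,u₀(x),θ₀(x)}` at every `x` (the hypotheses of `S6` verbatim), every
`|β| ≤ β₀` and `ε > 0`: `∃ τ₀ ∀ τ ≥ τ₀ ∃ N₀ ∀ x₀ ∈ 𝕋³ ∀ σ ∈ [σ₁,σ₂] ∀ N ≥ N₀ ∀ Φ`, under the GLOBAL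
equilibrium law `localGibbsLaw σ 1 (u₀ x₀) (θ₀ x₀)` (constant activity, drift and temperature — the
data of the block at `x₀` after the dictionary; flow-INVARIANT), the window functional of the FROZEN
observable `v ↦ F(x₀, v)` obeys `∫ exp(β Σ_i w_N⁻¹∫₀^{w_N} F(x₀, v_i(r)) dr) ≤ e^{ε(N+1)}`. This is the
engine-agnostic statement every sibling targets at equilibrium (TwoClocks `EquilibriumFastWindowLD`
stmt-14440 restricted to the class; this route's rungs 9531/9532 are its second cumulants; the
gossip engine `OneFlightLayeredChaos` is to PRODUCE it), CORRECTLY QUANTIFIED for consumption by a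
spatial transfer: pointwise-in-`σ` constants (14440 → 14443) cannot serve blocks of different
activity (the card's correctness point, confirmed by both triagers); uniformity in `x₀` over the
compact torus replaces "uniform over compact `(θ₀, A, b, G)`-families in the topology of joint
continuity" (triage r1-2 sharpening (1): the class is NOT totally bounded in weighted sup-norm —
`cex/osc_G_family.py` — so no finite net; here the family IS the continuous field of frozen data);
eventually-in-`τ` is free at equilibrium (window monotonicity along integer multiples by invariance
+ Hölder, remainder `< τ₀` by Jensen in time: `Λ(β;t) ≤ (mτ₀/t)Λ(β;τ₀) + Λ_stat(β)/m`). Why it might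
fail: as the crux (no print at fixed density; all scaled cumulants must vanish); false for the free
gas and as `σ₁ → 0` (Disproof §1), hence the density floor. Size XL — the crux's dynamical content. -/
theorem stub_frozenEquilibriumCore :
    ∃ σ₀ : ℝ, 0 < σ₀ ∧ ∀ (θ₀ : T3 → ℝ) (u₀ : T3 → V3), Continuous θ₀ → Continuous u₀ →
      (∀ x, 0 < θ₀ x) → ∀ σ₁ σ₂ : ℝ, 0 < σ₁ → σ₁ ≤ σ₂ → σ₂ < σ₀ →
      ∀ C : ℝ, 0 ≤ C → ∃ β₀ : ℝ, 0 < β₀ ∧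
      ∀ (A : T3 → Fin 3 → Fin 3 → ℝ) (H : T3 × ℝ → ℝ) (b : T3 → V3) (G : T3 × ℝ → ℝ),
      Continuous A → Continuous H → Continuous b → Continuous G →
      ∀ (F : T3 × V3 → ℝ), (∀ y, F y =
        H (y.1, ‖y.2 - u₀ y.1‖ ^ 2) *
            (∑ j : Fin 3, ∑ k : Fin 3, A y.1 j k * ((y.2 - u₀ y.1) j * (y.2 - u₀ y.1) k)) +
          (∑ j : Fin 3, b y.1 j * (y.2 - u₀ y.1) j) * G (y.1, ‖y.2 - u₀ y.1‖ ^ 2)) →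
      (∃ B : ℝ, ∀ y, |F y| ≤ B) → (∀ y, |F y| ≤ C * (1 + ‖y.2‖ ^ 2)) →
      (∀ x, ∫ v, F (x, v) * localMaxwellian 1 (θ₀ x) (u₀ x) v = 0) →
      (∀ x (j : Fin 3), ∫ v, F (x, v) * v j * localMaxwellian 1 (θ₀ x) (u₀ x) v = 0) →
      (∀ x, ∫ v, F (x, v) * ‖v‖ ^ 2 * localMaxwellian 1 (θ₀ x) (u₀ x) v = 0) →
      ∀ β : ℝ, |β| ≤ β₀ → ∀ ε : ℝ, 0 < ε → ∃ τ₀ : ℝ, 0 < τ₀ ∧ ∀ τ : ℝ, τ₀ ≤ τ → ∃ N₀ : ℕ,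
      ∀ x₀ : T3, ∀ σ ∈ Set.Icc σ₁ σ₂, ∀ N : ℕ, N₀ ≤ N →
      ∀ Φ : HardSphereFlow (Literature.Analysis.FluidPDE.Torus.geometry (Fin 3)) (hsDiameter σ N) (N + 1),
        ∫⁻ z, ENNReal.ofReal (Real.exp (β * ∑ i : Fin (N + 1),
          (τ * ((N : ℝ) + 1) ^ (-(1 / 3 : ℝ)))⁻¹ *
            ∫ r in (0 : ℝ)..(τ * ((N : ℝ) + 1) ^ (-(1 / 3 : ℝ))), F (x₀, (((Φ.flow r z) i).2))))
          ∂(localGibbsLaw σ (fun _ => 1) (fun _ => u₀ x₀) (fun _ => θ₀ x₀) N Φ) ≤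
        ENNReal.ofReal (Real.exp (ε * ((N : ℝ) + 1))) := by
  sorry

/-- **Stub 5 — THE CHESSBOARD–CORRIDOR TRANSFER** (`C⁺ ∧` statics `⟹ S6`): static freezing
(stub 2), local influence locality (stub 3), the frozen equilibrium core (stub 4) and the window
transfer `S5` (Rényi quasi-invariance in its consumable form, = `Sketch.stub_windowTransfer`, derived
from stub 1 by the landed glue `stub_windowTransfer_of_renyi`) imply the bounded-class local-Gibbs
window LD `S6` (= `Sketch.stub_boundedClassWindowLD`, verbatim). Proof plan (module docstring, T-a/b/c):
27-colour Hölder over blocks of side `L(N) → 0` indexed by INITIAL positions, coefficient freezing and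
localisation under `λ_loc` (landed S1, S2, S4 + `S5` + stub 3 with `K = pt`; all errors `o(N)` because
`F` is bounded); measure freezing per colour (stub 2, `β ↦ qβ`); grand-canonical passage and
factorisation over same-colour regions by the spatial Markov property of the hard-core law given the
corridors, block occupation large deviations as a product of one-block bounds (cluster-expansion
statics at packing `≤ η₀`, Ruelle1969 Ch. 3–4; KipnisLandim1999 Ch. 6 Lemma 1.8 for the sub-lattice
Hölder template); per block the annulus comparison with the block torus (`e^{o(N_b)}`), forecast →
true torus dynamics (stub 3, compact constant-profile family), margins `B·o(N_b)`, Galilean/scaling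
dictionary `(σ'', τ'') = (σ, τ)·((N''+1)/(N+1))^{1/3}/L''`, and stub 4 at `x₀ = x_b`;
`η₀ := min(σ₀³/2, 1/8)`, `β₀^{S6} := β₀^{core}(2C(1 + sup‖u₀‖²))/(27·2q)`. Size L–XL as a
formalisation (hard-core DLR / ensemble statics are not in the tree: candidate definition request
"grand-canonical hard-sphere law in a region with boundary configuration"); the mathematics is
standard. Honest failure mode: none known for bounded `F` — every step is kinematic or static. -/
theorem stub_chessboardTransfer :
    (∀ (a θ₀ : T3 → ℝ) (u₀ : T3 → V3), Continuous a → Continuous θ₀ → Continuous u₀ →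
    (∀ x, 0 < a x) → (∀ x, 0 < θ₀ x) → ∀ σ : ℝ, 0 < σ → σ ≤ 1 / 2 →
    ∀ p : ℝ, 1 < p → ∀ δ : ℝ, 0 < δ → ∃ ρ₀ : ℝ, 0 < ρ₀ ∧
    ∀ π : T3 → T3, Measurable π → (∀ x, dist (π x) x ≤ ρ₀) → ∀ N : ℕ,
      ∫⁻ z, ENNReal.ofReal (canonicalDensity (Literature.Analysis.FluidPDE.Torus.geometry (Fin 3))
            (hsDiameter σ N) (N + 1) (localGibbsProfile a u₀ θ₀) z) ^ p *
          ENNReal.ofReal (canonicalDensity (Literature.Analysis.FluidPDE.Torus.geometry (Fin 3))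
            (hsDiameter σ N) (N + 1) (localGibbsProfile (a ∘ π) (u₀ ∘ π) (θ₀ ∘ π)) z) ^ (1 - p)
        ∂(liouville (Literature.Analysis.FluidPDE.Torus.geometry (Fin 3)) (N + 1) (hsDiameter σ N)) ≤
      ENNReal.ofReal (Real.exp (p * (δ * ((N : ℝ) + 1))))) →
    (∀ (K : Type) [TopologicalSpace K] [CompactSpace K]
      (a θ₀ : K → T3 → ℝ) (u₀ : K → T3 → V3) (s : K → ℝ),
      Continuous (Function.uncurry a) → Continuous (Function.uncurry θ₀) →
      Continuous (Function.uncurry u₀) → Continuous s →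
      (∀ k x, 0 < a k x) → (∀ k x, 0 < θ₀ k x) → (∀ k, 0 < s k) → (∀ k, s k ≤ 1 / 2) →
    ∀ (T lam δ : ℝ), 0 < T → 0 < lam → 0 < δ → ∃ R₀ : ℝ, 0 < R₀ ∧ ∀ R : ℝ, R₀ ≤ R →
    ∃ N₀ : ℕ, ∀ k : K, ∀ N : ℕ, N₀ ≤ N →
    ∀ (Φ : HardSphereFlow (Literature.Analysis.FluidPDE.Torus.geometry (Fin 3)) (hsDiameter (s k) N) (N + 1))
      (Ψ : (n : ℕ) →
        HardSphereFlow (Literature.Analysis.FluidPDE.Torus.geometry (Fin 3)) (hsDiameter (s k) N) n),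
      ∫⁻ z, ENNReal.ofReal (Real.exp (lam *
          ((Finset.univ.filter fun i : Fin (N + 1) =>
              ∃ t ∈ Set.Icc (0 : ℝ) (T * ((N : ℝ) + 1) ^ (-(1 / 3 : ℝ))),
                (Φ.flow t z) i ≠
                  localClusterState Ψ (R * ((N : ℝ) + 1) ^ (-(1 / 3 : ℝ))) t z i).card : ℝ)))
        ∂(localGibbsLaw (s k) (a k) (u₀ k) (θ₀ k) N Φ) ≤
      ENNReal.ofReal (Real.exp (δ * ((N : ℝ) + 1)))) →
    (∃ σ₀ : ℝ, 0 < σ₀ ∧ ∀ (θ₀ : T3 → ℝ) (u₀ : T3 → V3), Continuous θ₀ → Continuous u₀ →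
      (∀ x, 0 < θ₀ x) → ∀ σ₁ σ₂ : ℝ, 0 < σ₁ → σ₁ ≤ σ₂ → σ₂ < σ₀ →
      ∀ C : ℝ, 0 ≤ C → ∃ β₀ : ℝ, 0 < β₀ ∧
      ∀ (A : T3 → Fin 3 → Fin 3 → ℝ) (H : T3 × ℝ → ℝ) (b : T3 → V3) (G : T3 × ℝ → ℝ),
      Continuous A → Continuous H → Continuous b → Continuous G →
      ∀ (F : T3 × V3 → ℝ), (∀ y, F y =
        H (y.1, ‖y.2 - u₀ y.1‖ ^ 2) *
            (∑ j : Fin 3, ∑ k : Fin 3, A y.1 j k * ((y.2 - u₀ y.1) j * (y.2 - u₀ y.1) k)) +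
          (∑ j : Fin 3, b y.1 j * (y.2 - u₀ y.1) j) * G (y.1, ‖y.2 - u₀ y.1‖ ^ 2)) →
      (∃ B : ℝ, ∀ y, |F y| ≤ B) → (∀ y, |F y| ≤ C * (1 + ‖y.2‖ ^ 2)) →
      (∀ x, ∫ v, F (x, v) * localMaxwellian 1 (θ₀ x) (u₀ x) v = 0) →
      (∀ x (j : Fin 3), ∫ v, F (x, v) * v j * localMaxwellian 1 (θ₀ x) (u₀ x) v = 0) →
      (∀ x, ∫ v, F (x, v) * ‖v‖ ^ 2 * localMaxwellian 1 (θ₀ x) (u₀ x) v = 0) →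
      ∀ β : ℝ, |β| ≤ β₀ → ∀ ε : ℝ, 0 < ε → ∃ τ₀ : ℝ, 0 < τ₀ ∧ ∀ τ : ℝ, τ₀ ≤ τ → ∃ N₀ : ℕ,
      ∀ x₀ : T3, ∀ σ ∈ Set.Icc σ₁ σ₂, ∀ N : ℕ, N₀ ≤ N →
      ∀ Φ : HardSphereFlow (Literature.Analysis.FluidPDE.Torus.geometry (Fin 3)) (hsDiameter σ N) (N + 1),
        ∫⁻ z, ENNReal.ofReal (Real.exp (β * ∑ i : Fin (N + 1),
          (τ * ((N : ℝ) + 1) ^ (-(1 / 3 : ℝ)))⁻¹ *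
            ∫ r in (0 : ℝ)..(τ * ((N : ℝ) + 1) ^ (-(1 / 3 : ℝ))), F (x₀, (((Φ.flow r z) i).2))))
          ∂(localGibbsLaw σ (fun _ => 1) (fun _ => u₀ x₀) (fun _ => θ₀ x₀) N Φ) ≤
        ENNReal.ofReal (Real.exp (ε * ((N : ℝ) + 1)))) →
    (∀ (a θ₀ : T3 → ℝ) (u₀ : T3 → V3), Continuous a → Continuous θ₀ → Continuous u₀ →
      (∀ x, 0 < a x) → (∀ x, 0 < θ₀ x) → ∀ σ : ℝ, 0 < σ → σ ≤ 1 / 2 →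
      ∃ q : ℝ, 1 ≤ q ∧ ∀ τ : ℝ, 0 < τ → ∀ δ : ℝ, 0 < δ →
      ∀ Φ : (N : ℕ) →
        HardSphereFlow (Literature.Analysis.FluidPDE.Torus.geometry (Fin 3)) (hsDiameter σ N) (N + 1),
      ∃ N₀ : ℕ, ∀ N : ℕ, N₀ ≤ N → ∀ r ∈ Set.Icc (0 : ℝ) (τ * ((N : ℝ) + 1) ^ (-(1 / 3 : ℝ))),
      ∀ G : Config (N + 1) (Fin 3) T3 → ℝ≥0∞, Measurable G →
        ∫⁻ z, G ((Φ N).flow r z) ∂(localGibbsLaw σ a u₀ θ₀ N (Φ N)) ≤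
          ENNReal.ofReal (Real.exp (δ * ((N : ℝ) + 1))) *
            (∫⁻ z, G z ^ q ∂(localGibbsLaw σ a u₀ θ₀ N (Φ N))) ^ (1 / q)) →
    ∃ η₀ : ℝ, 0 < η₀ ∧ ∀ (a θ₀ : T3 → ℝ) (u₀ : T3 → V3), Continuous a → Continuous θ₀ → Continuous u₀ →
      (∀ x, 0 < a x) → (∀ x, 0 < θ₀ x) → ∀ σ : ℝ, 0 < σ → σ ^ 3 * (⨆ x, a x) ≤ η₀ * ∫ x, a x →
      ∀ Φ : (N : ℕ) →
        HardSphereFlow (Literature.Analysis.FluidPDE.Torus.geometry (Fin 3)) (hsDiameter σ N) (N + 1),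
      ∀ C : ℝ, 0 ≤ C → ∃ β₀ : ℝ, 0 < β₀ ∧
      ∀ (A : T3 → Fin 3 → Fin 3 → ℝ) (H : T3 × ℝ → ℝ) (b : T3 → V3) (G : T3 × ℝ → ℝ),
      Continuous A → Continuous H → Continuous b → Continuous G →
      ∀ (F : T3 × V3 → ℝ), (∀ y, F y =
        H (y.1, ‖y.2 - u₀ y.1‖ ^ 2) *
            (∑ j : Fin 3, ∑ k : Fin 3, A y.1 j k * ((y.2 - u₀ y.1) j * (y.2 - u₀ y.1) k)) +
          (∑ j : Fin 3, b y.1 j * (y.2 - u₀ y.1) j) * G (y.1, ‖y.2 - u₀ y.1‖ ^ 2)) →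
      (∃ B : ℝ, ∀ y, |F y| ≤ B) → (∀ y, |F y| ≤ C * (1 + ‖y.2‖ ^ 2)) →
      (∀ x, ∫ v, F (x, v) * localMaxwellian 1 (θ₀ x) (u₀ x) v = 0) →
      (∀ x (j : Fin 3), ∫ v, F (x, v) * v j * localMaxwellian 1 (θ₀ x) (u₀ x) v = 0) →
      (∀ x, ∫ v, F (x, v) * ‖v‖ ^ 2 * localMaxwellian 1 (θ₀ x) (u₀ x) v = 0) →
      ∀ β : ℝ, |β| ≤ β₀ → ∀ ε : ℝ, 0 < ε → ∃ τ : ℝ, 0 < τ ∧ ∃ N₀ : ℕ, ∀ N : ℕ, N₀ ≤ N →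
        ∫⁻ z, ENNReal.ofReal (Real.exp (β * ∑ i : Fin (N + 1),
          (τ * ((N : ℝ) + 1) ^ (-(1 / 3 : ℝ)))⁻¹ *
            ∫ r in (0 : ℝ)..(τ * ((N : ℝ) + 1) ^ (-(1 / 3 : ℝ))), F (((Φ N).flow r z) i)))
          ∂(localGibbsLaw σ a u₀ θ₀ N (Φ N)) ≤ ENNReal.ofReal (Real.exp (ε * ((N : ℝ) + 1))) := by
  sorry

/-! ## Composition -/

/-- **The line closes the crux modulo its stubs.** `S6` is produced by the chessboard–corridor
transfer from stubs 2–4 and the window transfer; the landed `Sketch` assembly (p88778) with the landed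
S1 (p86471), S2 (p86164), S3 (p91214), S4 (p86158) and S5 (landed glue p89950 on `stub_windowRenyi`)
then yields `KineticCurrentsWindowLDUniform` BY NAME. -/
theorem KineticCurrentsWindowLDUniform_of : KineticCurrentsWindowLDUniform :=
  Summit.AtomisticToContinuum.HydrodynamicLimit.Theorems.KineticCurrentsWindowLDUniformSketch.stub_assembly
    Summit.AtomisticToContinuum.HydrodynamicLimit.Theorems.KineticCurrentsWindowLDUniformSketch.stub_jensenTimeSum
    Summit.AtomisticToContinuum.HydrodynamicLimit.Theorems.KineticCurrentsWindowLDUniformSketch.stub_fibreExpMoment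
    Summit.AtomisticToContinuum.HydrodynamicLimit.Theorems.KineticCurrentsWindowLDUniformSketch.stub_classTruncation
    Summit.AtomisticToContinuum.HydrodynamicLimit.Theorems.KineticCurrentsWindowLDUniformSketch.stub_pathwiseWindow
    (Summit.AtomisticToContinuum.HydrodynamicLimit.Theorems.KineticCurrentsWindowLDUniformSketch.stub_windowTransfer_of_renyi
      stub_windowRenyi)
    (stub_chessboardTransfer stub_staticFreezing stub_localInfluence stub_frozenEquilibriumCore
      (Summit.AtomisticToContinuum.HydrodynamicLimit.Theorems.KineticCurrentsWindowLDUniformSketch.stub_windowTransfer_of_renyi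
        stub_windowRenyi))

end Summit.AtomisticToContinuum.HydrodynamicLimit.Cruxes.KineticCurrentsWindowLDUniform.SigmaUniformEquilibriumTransfer
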